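import Summits.BirchSwinnertonDyer.Rank1Residual.ManinAdditive.DegeneracyOrbitLaws
import Summits.BirchSwinnertonDyer.Rank1Residual.ManinAdditive.NineShiftFineReduction
import HarnessLib
import HarnessLib.Audit.Tags

/-!
# E-es-94♯ (and already the parabolic E-es-94) ⟹ (CD₉) `DegeneracyOrbit.ConjDefectLawNine` — PROVED EDGES
# (es g23, MEMO-es §37.10; cell `bsd-f2-manin`, T-es-32, typer g16)

TYPER FRAMING.  LENS = es.  SOURCE = HOME/es/NineShiftConjDefect-es-g23.lean sha16 **f97d432258d7a23d** (279 l.; farm rc 0 ·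
0 err · 0 warn · 0 sorry per es; audit: 3 proof-of-item edges, 0 new obligation nodes; MEMO sha16 3301c2417b90b11a,
HOME/es/g23/memo37_10.md ec6f3bb274f85336), landed VERBATIM except this header and one added docstring (`plusCoord_spec`).
NOTHING NEW IS ASSERTED: two computable-free helper definitions (`plusCoord`, `plusCharMod3` — the plus coordinate of
`{∞, γ∞}_f` and its reduction mod 3) and THEOREMS.  What the file does: it REMOVES the paper bridge «E-es-94♯ ⟹ (H₉ mod 3)
⟹ (CD₉)» (Manin presentation + duality, MEMO-es §37) from the es chain of C3 — the f-free group law E-es-94♯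
`NineShiftInvariantIsDiamond` (typed in `NineShiftEqualiserLaw.lean`, reduced to six paper-proved obligation nodes
{E-es-98, E-es-102…106} in `NineShiftFineReduction.lean`) now implies (CD₉) `DegeneracyOrbit.ConjDefectLawNine` IN LEAN,
and so do already the weaker parabolic law E-es-94 and the six fine obligations (`conjDefectLawNine_of_fine`); downstream
by name (tree, `DegeneracyOrbitLaws.lean`): `ThreeAdicPolarWitness` on the squarefull additive-at-3 locus and `¬ 3 ∣ c(W)`
given `KatoFactThreeAt W D.f`, optimality and `PlusIndexPrimeTo 3 D.f` (`not_three_dvd_maninConstant_of_fine`, the es-input of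
C3 `kato_shift_three` BY NAME — TURNKEY-es-23).  REFUTER VERDICTS: R-es-49 (light) / R-es-48 PENDING at filing.
bears_on: stmt-BirchSwinnertonDyer-22968.  PARTITION 0 · beyond-print theorem: no (edges) · BSD is not proved by this;
Manin's law `c ∈ {±1}` is not proved by this; C3 stays OPEN.
-/

/-!
## es's sketch docstring (verbatim)
# The group law E-es-94♯ DECIDES the es-side of C3: `NineShiftInvariantIsDiamond → ConjDefectLawNine` (PROVED)
# (es g23, MEMO-es §37.10; cell `bsd-f2-manin`)

LENS = Eisenstein-series / Γ₀-side (`bsd-f2-manin-es` g23).  No Manin presentation, no duality: the PLUS-PERIOD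
CHARACTER MOD 3 `j̄_f : Γ₀(N) → ℤ/3`, `γ ↦ k(γ) mod 3` where `{∞, γ∞}_f + conj = k(γ)·Ω⁺_f`, is an ADDITIVE
character of `Γ₀(N)` (`cuspSymbol_mul`); `PlusIndexPrimeTo 3 f` says exactly that `j̄_f` is NOT a diamond class
(some `Γ₁(N)`-period has plus coordinate prime to `3`); so the f-free law E-es-94♯ (`NineShiftInvariantIsDiamond`:
9-shift-invariant additive characters of `Γ₀(N)`, `9 ∣ N`, are diamond) forces `j̄_f` NOT to be 9-shift invariant,
i.e. some conjugation defect `D(γ) = {∞, δ∞} − {∞, γ∞}` (`δ = diag(9,1) γ diag(9,1)⁻¹`) has plus coordinate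
prime to `3` — which is `ConjDefectUnit f 9`, the tree's (CD₉) `DegeneracyOrbit.ConjDefectLawNine` pointwise.
The plus character is moreover PARABOLIC
(`cuspSymbol_eq_zero_of_trace_two`: periods of parabolic elements vanish), so already the WEAKER homological law
E-es-94 `ParabolicNineShiftInvariantIsDiamond` gives (CD₉) (`conjDefectLawNine_of_parabolicNineShiftInvariantIsDiamond`).
Consequences BY NAME (tree corollaries of (CD₉)): `ThreeAdicPolarWitness` at squarefull additive-at-3 levels and
`¬ 3 ∣ c(W)` given Kato at 3 — now from the SIX f-free obligations {III, E-es-102…106} of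
`NineShiftFineReduction.lean` (`conjDefectLawNine_of_fine`, `not_three_dvd_maninConstant_of_fine`).
PARTITION 0 · beyond-print theorem: no (edges; the six obligations are theorems on paper, MEMO-es §37.8–37.9,
referee R-es-48 pending) · BSD is not proved by this; Manin's conjecture is not proved by this; C3 OPEN.
-/

open scoped Classical MatrixGroups ModularForm ComplexConjugate

open CongruenceSubgroup Complex Literature.NumberTheory.EllipticCurves
  Literature.NumberTheory.EllipticCurves.ModularForms

noncomputable section

open Summit.BirchSwinnertonDyer.Rank1Residual.ManinAdditive.KatoCurve
open Summit.BirchSwinnertonDyer.Rank1Residual.ManinAdditive.Gamma1Lattice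
open Summit.BirchSwinnertonDyer.Rank1Residual.ManinAdditive.DegeneracyOrbit
open Summit.BirchSwinnertonDyer.BirchSwinnertonDyer.Theorems.ManinLocalTwoThree (gamma0_det_entries g0Of_entries)

namespace Summit.BirchSwinnertonDyer.Rank1Residual.ManinAdditive.NineShiftEqualiser

variable {N : ℕ} (f : CuspForm (Gamma0 N) 2)

section PlusChar

/-- the integer PLUS COORDINATE `k(γ)` of the period `{∞, γ∞}_f`: `{∞, γ∞}_f + conj = k(γ)·Ω⁺_f`
(for `re Λ_f = ℤ·Ω⁺_f/2`; a choice, pinned down by `plusCoord_spec` when `Ω⁺_f ≠ 0`). -/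
noncomputable def plusCoord (hre : realPeriods f = AddSubgroup.zmultiples (plusPeriod f / 2)) (γ : Gamma0 N) : ℤ :=
  (exists_add_conj_eq_int_mul f hre (cuspSymbol_mem_periodLattice f γ)).choose

/-- defining property of `plusCoord`: `{∞, γ∞}_f + conj = k(γ)·Ω⁺_f`. -/
theorem plusCoord_spec (hre : realPeriods f = AddSubgroup.zmultiples (plusPeriod f / 2)) (γ : Gamma0 N) :
    cuspSymbol f γ + conj (cuspSymbol f γ) = (plusCoord f hre γ : ℂ) * (plusPeriod f : ℂ) :=
  (exists_add_conj_eq_int_mul f hre (cuspSymbol_mem_periodLattice f γ)).choose_spec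

/-- THE PLUS CHARACTER MOD 3 `j̄_f : Γ₀(N) → ℤ/3`, `γ ↦ k(γ) mod 3`. -/
noncomputable def plusCharMod3 (hre : realPeriods f = AddSubgroup.zmultiples (plusPeriod f / 2)) :
    Gamma0 N → ZMod 3 :=
  fun γ => ((plusCoord f hre γ : ℤ) : ZMod 3)

/-- `k` is additive (Manin: `γ ↦ {∞, γ∞}_f` is a homomorphism). -/
theorem plusCoord_mul [NeZero N] (hre : realPeriods f = AddSubgroup.zmultiples (plusPeriod f / 2))
    (hΩ : plusPeriod f ≠ 0) (γ δ : Gamma0 N) :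
    plusCoord f hre (γ * δ) = plusCoord f hre γ + plusCoord f hre δ := by
  have h1 := plusCoord_spec f hre (γ * δ)
  have h2 := plusCoord_spec f hre γ
  have h3 := plusCoord_spec f hre δ
  rw [cuspSymbol_mul_holds f γ δ, map_add] at h1
  have hΩC : (plusPeriod f : ℂ) ≠ 0 := by exact_mod_cast hΩ
  have key : ((plusCoord f hre (γ * δ) : ℤ) : ℂ) * (plusPeriod f : ℂ)
      = (((plusCoord f hre γ + plusCoord f hre δ : ℤ)) : ℂ) * (plusPeriod f : ℂ) := by
    push_cast
    linear_combination -h1 + h2 + h3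
  exact_mod_cast mul_right_cancel₀ hΩC key

/-- `j̄_f` is an additive character of `Γ₀(N)`. -/
theorem isAddChar_plusCharMod3 [NeZero N] (hre : realPeriods f = AddSubgroup.zmultiples (plusPeriod f / 2))
    (hΩ : plusPeriod f ≠ 0) : IsAddChar (plusCharMod3 f hre) := by
  intro γ δ
  simp only [plusCharMod3, plusCoord_mul f hre hΩ, Int.cast_add]

/-- PERIODS OF PARABOLIC ELEMENTS VANISH (explicit entries): `{∞, γ∞}_f = 0` for `γ = (a b; c d) ∈ Γ₀(N)` with
`a + d = 2` — `γ` fixes a cusp `x`, and Manin's relation `{∞, γx} = {∞, γ∞} + {∞, x}` with `γx = x` kills the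
period (`x = ∞` when `c = 0`; else `x = (a − d)/(2c)`, the double root, with `c x + d = (a + d)/2 = 1`). -/
theorem cuspSymbol_g0Of_eq_zero_of_trace_two [NeZero N] (a b c d : ℤ) (hdet : a * d - b * c = 1)
    (hc : (N : ℤ) ∣ c) (htr : a + d = 2) : cuspSymbol f (g0Of a b c d hdet hc) = 0 := by
  by_cases hc0 : c = 0
  · subst hc0
    simp [cuspSymbol, g0Of, slOf]
  · have hcQ : (c : ℚ) ≠ 0 := by exact_mod_cast hc0
    have htrQ : (a : ℚ) + d = 2 := by exact_mod_cast htr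
    have hdetQ : (a : ℚ) * d - b * c = 1 := by exact_mod_cast hdet
    obtain ⟨x, hx2⟩ : ∃ x : ℚ, 2 * (c : ℚ) * x = a - d :=
      ⟨((a : ℚ) - d) / (2 * c), by field_simp⟩
    have hcx : (c : ℚ) * x + d = 1 := by linear_combination hx2 / 2 + htrQ / 2
    have hcx0 : (c : ℚ) * x + d ≠ 0 := by rw [hcx]; exact one_ne_zero
    have hG : (2 * (c : ℚ)) * (a * x + b - x) = 0 := by
      linear_combination ((a : ℚ) - 1) * hx2 + ((a : ℚ) + 1) * htrQ - 2 * hdetQ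
    have hfix' : (a : ℚ) * x + b = x := by
      rcases mul_eq_zero.mp hG with h2c | h
      · exact absurd h2c (mul_ne_zero two_ne_zero hcQ)
      · linear_combination h
    have hfix : ((a : ℚ) * x + b) / ((c : ℚ) * x + d) = x := by rw [hcx, div_one, hfix']
    have H := manin_slOf f a b c d hdet hc x hcx0
    rw [hfix] at H
    linear_combination -H

/-- PERIODS OF PARABOLIC ELEMENTS VANISH: `{∞, γ∞}_f = 0` for every `γ ∈ Γ₀(N)` of trace `2`. -/
theorem cuspSymbol_eq_zero_of_trace_two [NeZero N] (γ : Gamma0 N)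
    (htr : (γ.1 : SL(2, ℤ)) 0 0 + (γ.1 : SL(2, ℤ)) 1 1 = 2) : cuspSymbol f γ = 0 := by
  have hcN : (N : ℤ) ∣ (γ.1 : SL(2, ℤ)) 1 0 := by
    have h := γ.2
    rw [Gamma0_mem] at h
    exact (ZMod.intCast_zmod_eq_zero_iff_dvd _ N).mp h
  rw [← g0Of_entries γ (gamma0_det_entries γ) hcN]
  exact cuspSymbol_g0Of_eq_zero_of_trace_two f _ _ _ _ _ _ htr

/-- `j̄_f` is PARABOLIC (kills every element of trace `2`). -/
theorem isParabolicChar_plusCharMod3 [NeZero N] (hre : realPeriods f = AddSubgroup.zmultiples (plusPeriod f / 2))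
    (hΩ : plusPeriod f ≠ 0) : IsParabolicChar (plusCharMod3 f hre) := by
  intro γ htr
  have hk := plusCoord_spec f hre γ
  rw [cuspSymbol_eq_zero_of_trace_two f γ htr, map_zero, add_zero] at hk
  have hΩC : (plusPeriod f : ℂ) ≠ 0 := by exact_mod_cast hΩ
  have h0 : ((plusCoord f hre γ : ℤ) : ℂ) = ((0 : ℤ) : ℂ) := by
    push_cast
    exact (mul_right_cancel₀ hΩC (by rw [zero_mul]; exact hk.symm))
  have : plusCoord f hre γ = 0 := by exact_mod_cast h0
  simp [plusCharMod3, this]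

/-- If `[Λ_f⁺ : Λ₁(f)⁺]` is prime to `3` (`PlusIndexPrimeTo 3 f`), then `j̄_f` is NOT a diamond class. -/
theorem not_isDiamondChar_plusCharMod3 (hre : realPeriods f = AddSubgroup.zmultiples (plusPeriod f / 2))
    (hΩ : plusPeriod f ≠ 0) (hd : PlusIndexPrimeTo 3 f) : ¬ IsDiamondChar (plusCharMod3 f hre) := by
  intro hdia
  have hS : ∀ g ∈ Set.range (fun γ : Gamma1 N ↦ cuspSymbol f ⟨(γ : SL(2, ℤ)), Gamma1_in_Gamma0 N γ.2⟩),
      ∃ k : ℤ, g + conj g = 3 * (k : ℂ) * (plusPeriod f : ℂ) := by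
    rintro _ ⟨γ, rfl⟩
    have h0 : plusCharMod3 f hre ⟨(γ : SL(2, ℤ)), Gamma1_in_Gamma0 N γ.2⟩ = 0 := hdia γ.1 γ.2
    have hk := plusCoord_spec f hre ⟨(γ : SL(2, ℤ)), Gamma1_in_Gamma0 N γ.2⟩
    obtain ⟨m, hm⟩ := (ZMod.intCast_zmod_eq_zero_iff_dvd _ 3).mp h0
    refine ⟨m, ?_⟩
    simp only at hk ⊢
    rw [hk, hm]
    push_cast
    ring
  obtain ⟨x₀, hx₀, hx₀tr⟩ := exists_mem_add_conj_eq f hre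
  obtain ⟨y₀, hy₀, k₀, hk₀3, hk₀⟩ := hd x₀ hx₀
  obtain ⟨m, hm⟩ := add_conj_mem_three_of_closure hS hy₀
  have hΩC : (plusPeriod f : ℂ) ≠ 0 := by exact_mod_cast hΩ
  have hx : x₀ + conj x₀ = (plusPeriod f : ℂ) := hx₀tr
  have e : ((k₀ : ℤ) : ℂ) * (plusPeriod f : ℂ) = ((3 * m : ℤ) : ℂ) * (plusPeriod f : ℂ) := by
    push_cast
    have : (k₀ : ℂ) * (x₀ + conj x₀) = y₀ + conj y₀ := hk₀
    rw [hx, hm] at this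
    linear_combination this
  have hk : (k₀ : ℤ) = 3 * m := by exact_mod_cast mul_right_cancel₀ hΩC e
  exact hk₀3 (Int.natCast_dvd_natCast.mp ⟨m, hk⟩)

/-- the plus coordinate of a conjugation defect of ratio `t`. -/
theorem conjDefect_add_conj (hre : realPeriods f = AddSubgroup.zmultiples (plusPeriod f / 2)) (t : ℕ)
    (a b c d : ℤ) (hdet : a * d - b * (t * c) = 1) (hc : (N : ℤ) ∣ c) :
    conjDefect f t a b c d hdet hc + conj (conjDefect f t a b c d hdet hc)
      = ((plusCoord f hre (g0Of a (t * b) c d (by linear_combination hdet) hc)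
          - plusCoord f hre (g0Of a b (t * c) d hdet (Dvd.dvd.mul_left hc _)) : ℤ) : ℂ) * (plusPeriod f : ℂ) := by
  have h1 := plusCoord_spec f hre (g0Of a (t * b) c d (by linear_combination hdet) hc)
  have h2 := plusCoord_spec f hre (g0Of a b (t * c) d hdet (Dvd.dvd.mul_left hc _))
  unfold conjDefect
  rw [map_sub]
  push_cast
  linear_combination h1 - h2

/-- A conjugation defect of ratio `9` whose two matrices have different `j̄_f`-values is a UNIT defect. -/
theorem conjDefectUnit_of_plusCharMod3_ne (hre : realPeriods f = AddSubgroup.zmultiples (plusPeriod f / 2))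
    (a b c d : ℤ) (hdet : a * d - b * ((9 : ℕ) * c) = 1) (hc : (N : ℤ) ∣ c)
    (hne : plusCharMod3 f hre (g0Of a ((9 : ℕ) * b) c d (by linear_combination hdet) hc)
      ≠ plusCharMod3 f hre (g0Of a b ((9 : ℕ) * c) d hdet (Dvd.dvd.mul_left hc _))) :
    ConjDefectUnit f 9 := by
  refine ⟨a, b, c, d, hdet, hc, plusCoord f hre (g0Of a ((9 : ℕ) * b) c d (by linear_combination hdet) hc)
      - plusCoord f hre (g0Of a b ((9 : ℕ) * c) d hdet (Dvd.dvd.mul_left hc _)), ?_, ?_⟩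
  · intro h3
    apply hne
    simp only [plusCharMod3]
    rw [← sub_eq_zero, ← Int.cast_sub]
    exact (ZMod.intCast_zmod_eq_zero_iff_dvd _ 3).mpr h3
  · exact conjDefect_add_conj f hre 9 a b c d hdet hc

/-- If `j̄_f` is NOT 9-shift invariant, `f` has a unit conjugation defect of ratio `9`. -/
theorem conjDefectUnit_of_not_isNineShiftInvariant
    (hre : realPeriods f = AddSubgroup.zmultiples (plusPeriod f / 2))
    (h : ¬ IsNineShiftInvariant (plusCharMod3 f hre)) : ConjDefectUnit f 9 := by
  unfold IsNineShiftInvariant at h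
  push Not at h
  obtain ⟨a, b, c, d, hdet, hc, hne⟩ := h
  have hdet9 : a * d - b * ((9 : ℕ) * c) = 1 := by push_cast; linear_combination hdet
  apply conjDefectUnit_of_plusCharMod3_ne f hre a b c d hdet9 hc
  intro heq
  apply hne
  exact (congrArg (plusCharMod3 f hre) (g0Of_congr rfl (by push_cast; ring) rfl rfl _ _ _ _)).trans
    (heq.trans (congrArg (plusCharMod3 f hre) (g0Of_congr rfl rfl (by push_cast; ring) rfl _ _ _ _)))

end PlusChar

section Edge

/-- **E-es-94♯ ⟹ (CD₉) (PROVED).**  The f-free 9-shift equaliser law forces a unit conjugation defect of ratio `9`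
for every rational newform of level `9 ∣ N` with `[Λ_f⁺ : Λ₁(f)⁺]` prime to `3`. -/
theorem conjDefectLawNine_of_nineShiftInvariantIsDiamond (h : NineShiftInvariantIsDiamond) :
    ConjDefectLawNine := by
  intro N _ h9 f hf hQ hd
  have hΩ : plusPeriod f ≠ 0 := (IsNewform0.plusPeriod_pos_holds hf hQ).ne'
  obtain ⟨hre, -⟩ := realPeriods_eq_zmultiples_of_plusPeriod_ne_zero f hΩ
  by_contra hno
  have hinv : IsNineShiftInvariant (plusCharMod3 f hre) := by
    by_contra hni
    exact hno (conjDefectUnit_of_not_isNineShiftInvariant f hre hni)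
  have h9' : 9 ∣ N := by norm_num at h9; exact h9
  exact not_isDiamondChar_plusCharMod3 f hre hΩ hd
    (h N h9' (plusCharMod3 f hre) (isAddChar_plusCharMod3 f hre hΩ) hinv)

/-- **E-es-94 (PARABOLIC form, the weaker law) ⟹ (CD₉) (PROVED)** — `j̄_f` is parabolic, so the homological
law `ParabolicNineShiftInvariantIsDiamond` (`K₉^{mod 3}(N) = D_par(N)`, ENGINE 3′ census 39/39) already suffices. -/
theorem conjDefectLawNine_of_parabolicNineShiftInvariantIsDiamond (h : ParabolicNineShiftInvariantIsDiamond) :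
    ConjDefectLawNine := by
  intro N _ h9 f hf hQ hd
  have hΩ : plusPeriod f ≠ 0 := (IsNewform0.plusPeriod_pos_holds hf hQ).ne'
  obtain ⟨hre, -⟩ := realPeriods_eq_zmultiples_of_plusPeriod_ne_zero f hΩ
  by_contra hno
  have hinv : IsNineShiftInvariant (plusCharMod3 f hre) := by
    by_contra hni
    exact hno (conjDefectUnit_of_not_isNineShiftInvariant f hre hni)
  have h9' : 9 ∣ N := by norm_num at h9; exact h9
  exact not_isDiamondChar_plusCharMod3 f hre hΩ hd
    (h N h9' (plusCharMod3 f hre) (isAddChar_plusCharMod3 f hre hΩ) (isParabolicChar_plusCharMod3 f hre hΩ) hinv)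

/-- (CD₉) from the SIX f-free obligations of `NineShiftFineReduction.lean` (III + E-es-102…106). -/
theorem conjDefectLawNine_of_fine (hIII : ThreeShiftTowerDescent) (hbase : ThreeShiftBasePrimeToThree)
    (hcube : CubeStepDescent) (hcubeA : CubeStepAntiDescent) (hnine : ThreeShiftStepNine)
    (hanti : ThreeShiftAntiInvariantDescentAll) : ConjDefectLawNine :=
  conjDefectLawNine_of_nineShiftInvariantIsDiamond
    (nineShiftInvariantIsDiamond_of_fine' hIII hbase hcube hcubeA hnine hanti)

open WeierstrassCurve in
/-- **E-es-66|squarefull ⟸ E-es-94♯ (PROVED edge).** -/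
theorem threeAdicPolarWitness_of_nineShiftInvariantIsDiamond_squarefull (h : NineShiftInvariantIsDiamond)
    (W : WeierstrassCurve ℚ) [W.IsElliptic] {N : ℕ} [NeZero N] (D : ModularParametrizationData W N)
    (h3g : ¬ W.HasGoodReductionAtPrime 3) (h3m : ¬ W.HasMultiplicativeReductionAtPrime 3)
    (h9 : 3 ^ 2 ∣ N) (hsq : IsSquarefull N) (hd : PlusIndexPrimeTo 3 D.f) :
    ThreeAdicPolarWitness W W D.f :=
  threeAdicPolarWitness_of_conjDefectLawNine_squarefull (conjDefectLawNine_of_nineShiftInvariantIsDiamond h)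
    W D h3g h3m h9 hsq hd

open WeierstrassCurve in
/-- **3 ∤ c(W) ⟸ E-es-94♯ + Kato at 3 (PROVED edge)** at squarefull levels `9 ∣ N` with additive reduction at `3`,
optimality of the Manin lattice and `[Λ_f⁺ : Λ₁(f)⁺]` prime to `3`. -/
theorem not_three_dvd_maninConstant_of_nineShiftInvariantIsDiamond (h : NineShiftInvariantIsDiamond)
    (W : WeierstrassCurve ℚ) [W.IsElliptic] [W.IsGloballyMinimal] {N : ℕ} [NeZero N]
    (D : ModularParametrizationData W N) (hF : KatoFactThreeAt W D.f)
    (hopt : ∀ z ∈ D.L.lattice, ∃ w ∈ periodLattice D.f, z = D.c * w)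
    (h3g : ¬ W.HasGoodReductionAtPrime 3) (h3m : ¬ W.HasMultiplicativeReductionAtPrime 3)
    (h9 : 3 ^ 2 ∣ N) (hsq : IsSquarefull N) (hd : PlusIndexPrimeTo 3 D.f) : ¬ (3 : ℤ) ∣ D.c :=
  not_three_dvd_maninConstant_of_conjDefectLawNine (conjDefectLawNine_of_nineShiftInvariantIsDiamond h)
    W D hF hopt h3g h3m h9 hsq hd

open WeierstrassCurve in
/-- **3 ∤ c(W) from the six f-free obligations + Kato at 3 (PROVED edge).** -/
theorem not_three_dvd_maninConstant_of_fine (hIII : ThreeShiftTowerDescent) (hbase : ThreeShiftBasePrimeToThree)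
    (hcube : CubeStepDescent) (hcubeA : CubeStepAntiDescent) (hnine : ThreeShiftStepNine)
    (hanti : ThreeShiftAntiInvariantDescentAll)
    (W : WeierstrassCurve ℚ) [W.IsElliptic] [W.IsGloballyMinimal] {N : ℕ} [NeZero N]
    (D : ModularParametrizationData W N) (hF : KatoFactThreeAt W D.f)
    (hopt : ∀ z ∈ D.L.lattice, ∃ w ∈ periodLattice D.f, z = D.c * w)
    (h3g : ¬ W.HasGoodReductionAtPrime 3) (h3m : ¬ W.HasMultiplicativeReductionAtPrime 3)
    (h9 : 3 ^ 2 ∣ N) (hsq : IsSquarefull N) (hd : PlusIndexPrimeTo 3 D.f) : ¬ (3 : ℤ) ∣ D.c :=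
  not_three_dvd_maninConstant_of_nineShiftInvariantIsDiamond
    (nineShiftInvariantIsDiamond_of_fine' hIII hbase hcube hcubeA hnine hanti) W D hF hopt h3g h3m h9 hsq hd

end Edge

end Summit.BirchSwinnertonDyer.Rank1Residual.ManinAdditive.NineShiftEqualiser

end
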